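import Mathlib.NumberTheory.DirichletCharacter.Orthogonality
import Literature.NumberTheory.EllipticCurves.Newforms
import Literature.NumberTheory.EllipticCurves.EichlerShimuraPeriodsGamma1
import HarnessLib

/-!
# `S_k(Γ₁(N)) = ⊕_χ S_k(N, χ)`: the nebentypus components of a cusp form
(Diamond–Shurman §4.3, p. 119 and §5.2, p. 169)

Topic `NumberTheory/EllipticCurves` (classical modular forms). The diamond operators `⟨d⟩`,
`d ∈ (ℤ/Nℤ)ˣ`, form a commuting family of operators on `S_k(Γ₁(N))` representing the finite
abelian group `(ℤ/Nℤ)ˣ` (`diamondOp_mul_holds`, `diamondOp_one_eq_id`); a cusp form therefore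
decomposes into its **nebentypus components** `f_χ = φ(N)⁻¹ ∑_d χ(d⁻¹) ⟨d⟩ f ∈ S_k(N, χ)`
(`nebentypusComponent`, `nebentypusComponent_mem_nebentypusSubspace`,
`sum_nebentypusComponent : ∑_χ f_χ = f` by orthogonality of Dirichlet characters,
`DirichletCharacter.sum_characters_eq`). An operator commuting with the diamond operators
commutes with taking components (`map_nebentypusComponent`), so the components of a
`T_p`-eigenform are `T_p`-eigenforms with the same eigenvalue (`heckeT_nebentypusComponent_of_eq_smul`,
`heckeT_diamondOp_comm_holds`); some component of a non-zero form is non-zero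
(`exists_nebentypusComponent_ne_zero`); and if `⟨d⟩ f = c f` then `χ(d) = c` for every `χ` with
`f_χ ≠ 0` (`dirichlet_apply_eq_of_diamondOp_eq_smul`).

Everything is proved; the one definition is `nebentypusComponent`.

## References

* F. Diamond, J. Shurman, *A first course in modular forms* (2005), §4.3 p. 119, §5.2 p. 169
  [DiamondShurman2005].
-/

noncomputable section

open scoped MatrixGroups ModularForm
open CongruenceSubgroup

namespace Literature.NumberTheory.EllipticCurves.ModularForms

variable {N : ℕ} [NeZero N] {k : ℤ}

/-- The **`χ`-component** `f_χ = φ(N)⁻¹ ∑_{d ∈ (ℤ/Nℤ)ˣ} χ(d⁻¹) ⟨d⟩ f` of a cusp form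
`f ∈ S_k(Γ₁(N))` (Diamond–Shurman §5.2, p. 169). [cite: DiamondShurman2005, §5.2 p. 169] -/
def nebentypusComponent (χ : DirichletCharacter ℂ N) (f : CuspForm (Gamma1 N) k) : CuspForm (Gamma1 N) k :=
  ((N.totient : ℂ)⁻¹) • ∑ d : (ZMod N)ˣ, χ ((d⁻¹ : (ZMod N)ˣ) : ZMod N) • diamondOp N k (d : ZMod N) f

/-- `⟨e⟩ (⟨d⟩ f) = ⟨e d⟩ f` (`diamondOp_mul_holds`). [cite: DiamondShurman2005, §5.2 p. 168] -/
theorem diamondOp_diamondOp_apply (e d : (ZMod N)ˣ) (f : CuspForm (Gamma1 N) k) :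
    diamondOp N k (e : ZMod N) (diamondOp N k (d : ZMod N) f) = diamondOp N k ((e * d : (ZMod N)ˣ) : ZMod N) f := by
  rw [← Module.End.mul_apply, Units.val_mul, diamondOp_mul_holds N k (Units.isUnit e) (Units.isUnit d)]

/-- **`⟨e⟩ f_χ = χ(e) f_χ`**: reindex `d ↦ e⁻¹ d` in the average. [cite: DiamondShurman2005, §5.2 p. 169] -/
theorem diamondOp_nebentypusComponent (χ : DirichletCharacter ℂ N) (f : CuspForm (Gamma1 N) k) (e : (ZMod N)ˣ) :
    diamondOp N k (e : ZMod N) (nebentypusComponent χ f) = χ (e : ZMod N) • nebentypusComponent χ f := by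
  unfold nebentypusComponent
  rw [map_smul, map_sum, smul_comm]
  congr 1
  simp_rw [map_smul, diamondOp_diamondOp_apply, Finset.smul_sum, smul_smul]
  -- reindex the left-hand side by `d ↦ e⁻¹ d`
  rw [← Equiv.sum_comp (Equiv.mulLeft e⁻¹)]
  refine Finset.sum_congr rfl fun d _ => ?_
  simp only [Equiv.coe_mulLeft, mul_inv_cancel_left, mul_inv_rev, inv_inv]
  congr 1
  rw [Units.val_mul, map_mul, mul_comm]

/-- **`f_χ ∈ S_k(N, χ)`.** [cite: DiamondShurman2005, §5.2 p. 169] -/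
theorem nebentypusComponent_mem_nebentypusSubspace (χ : DirichletCharacter ℂ N) (f : CuspForm (Gamma1 N) k) :
    nebentypusComponent χ f ∈ nebentypusSubspace N k χ := by
  rw [nebentypusSubspace, Submodule.mem_iInf]
  intro d
  rw [LinearMap.mem_ker, LinearMap.sub_apply, LinearMap.smul_apply, LinearMap.id_apply,
    diamondOp_nebentypusComponent, sub_self]

/-- **`∑_χ f_χ = f`** (orthogonality: `∑_χ χ(d⁻¹) = φ(N) [d = 1]`, and `⟨1⟩ = 1`).
[cite: DiamondShurman2005, §5.2 p. 169] -/
theorem sum_nebentypusComponent (f : CuspForm (Gamma1 N) k) :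
    ∑ χ : DirichletCharacter ℂ N, nebentypusComponent χ f = f := by
  unfold nebentypusComponent
  rw [← Finset.smul_sum, Finset.sum_comm]
  simp_rw [← Finset.sum_smul, DirichletCharacter.sum_characters_eq, Units.val_eq_one, inv_eq_one, ite_smul,
    zero_smul, Finset.sum_ite_eq', Finset.mem_univ, if_true, Units.val_one]
  rw [show diamondOp N k (1 : ZMod N) f = f by rw [diamondOp_one_eq_id, LinearMap.id_apply], smul_smul,
    inv_mul_cancel₀ (by exact_mod_cast (Nat.totient_pos.2 (NeZero.pos N)).ne'), one_smul]

/-- **Some nebentypus component of a non-zero form is non-zero.** [cite: DiamondShurman2005, §5.2 p. 169] -/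
theorem exists_nebentypusComponent_ne_zero {f : CuspForm (Gamma1 N) k} (hf : f ≠ 0) :
    ∃ χ : DirichletCharacter ℂ N, nebentypusComponent χ f ≠ 0 := by
  by_contra h
  push Not at h
  apply hf
  rw [← sum_nebentypusComponent f]
  exact Finset.sum_eq_zero fun χ _ => h χ

/-- An endomorphism commuting with the diamond operators commutes with taking nebentypus
components. [folklore] -/
theorem map_nebentypusComponent (T : Module.End ℂ (CuspForm (Gamma1 N) k))
    (hT : ∀ d : (ZMod N)ˣ, T * diamondOp N k (d : ZMod N) = diamondOp N k (d : ZMod N) * T)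
    (χ : DirichletCharacter ℂ N) (f : CuspForm (Gamma1 N) k) :
    T (nebentypusComponent χ f) = nebentypusComponent χ (T f) := by
  unfold nebentypusComponent
  rw [map_smul, map_sum]
  congr 1
  refine Finset.sum_congr rfl fun d _ => ?_
  rw [map_smul, ← Module.End.mul_apply, hT d, Module.End.mul_apply]

/-- **The components of a `T_p`-eigenform are `T_p`-eigenforms with the same eigenvalue**
(`T_p` commutes with the diamond operators, `heckeT_diamondOp_comm_holds`). [cite: DiamondShurman2005, Prop. 5.2.4] -/
theorem heckeT_nebentypusComponent_of_eq_smul (p : ℕ) [NeZero p] {f : CuspForm (Gamma1 N) k} {a : ℂ}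
    (h : heckeT (Gamma1 N) k p f = a • f) (χ : DirichletCharacter ℂ N) :
    heckeT (Gamma1 N) k p (nebentypusComponent χ f) = a • nebentypusComponent χ f := by
  rw [map_nebentypusComponent _ (fun d => heckeT_diamondOp_comm_holds N k p (d : ZMod N)), h]
  unfold nebentypusComponent
  simp_rw [map_smul, Finset.smul_sum, smul_comm a]

/-- **If `⟨d⟩ f = c f` then `χ(d) = c` for every `χ` with `f_χ ≠ 0`** (`⟨d⟩ f_χ = c f_χ` by
commutativity, and `= χ(d) f_χ`). [folklore] -/
theorem dirichlet_apply_eq_of_diamondOp_eq_smul {f : CuspForm (Gamma1 N) k} {d : (ZMod N)ˣ} {c : ℂ}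
    (h : diamondOp N k (d : ZMod N) f = c • f) {χ : DirichletCharacter ℂ N} (hχ : nebentypusComponent χ f ≠ 0) :
    χ (d : ZMod N) = c := by
  have h1 : diamondOp N k (d : ZMod N) (nebentypusComponent χ f) = c • nebentypusComponent χ f := by
    rw [map_nebentypusComponent _ (fun e => ?_), h]
    · unfold nebentypusComponent
      simp_rw [map_smul, Finset.smul_sum, smul_comm c]
    · rw [← diamondOp_mul_holds N k (Units.isUnit d) (Units.isUnit e),
        ← diamondOp_mul_holds N k (Units.isUnit e) (Units.isUnit d), mul_comm]
  rw [diamondOp_nebentypusComponent] at h1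
  have h2 : (χ (d : ZMod N) - c) • nebentypusComponent χ f = 0 := by rw [sub_smul, h1, sub_self]
  exact sub_eq_zero.1 ((smul_eq_zero.1 h2).resolve_right hχ)

end Literature.NumberTheory.EllipticCurves.ModularForms

end
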